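/-
Copyright (c) 2026 the pub-hodgecm-mathlib formalisation cell (harness21).  Prover seat hodgecm-mathlib-F0P3a-p03 (g8), topic T5 = P8
«(C♯)hol interior», row «Cc (3′)» brick α (second hand of A-p19 (g19), desk F0P2-plan (g8)), 2026-08-31.
KERNEL module: THEOREMS ONLY (no definition, no named fact, no `sorry`, no instance, no notation).
-/
import Literature.NumberTheory.Automorphic.Liu2021.ThetaLiftFromLineCompactInvariance
import HarnessLib

/-!
# Node Cc of the (C♯)hol interior, brick α: ONE DEFINITE ARCHIMEDEAN PLACE THROUGH THE FRAME TRANSPORT — the element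
# `(u at w₀, 1 elsewhere; 1_f)` of `U(diag dV)(𝔸_{L⁺})` is the frame transport of an element of the compact factor `K_c`

Topic `NumberTheory/Automorphic/Liu2021`; namespace `Literature.NumberTheory.Automorphic.Liu2021`.  KERNEL: theorems only.  Cell hodgecm-mathlib
FLOOR 0, programme P2, topic T5 = P8 «(C♯)hol interior», node Cc = [Liu2021, Lem. D.2 (1)] at the complex places `w₀ ≠ w(ι)` (A-p19 (g19)'s
road note `F0/P2/A-p19/g19/cc/ROAD-Cc-3prime.A-p19g19.md`, step α of the (3′) assembly).

The adelic frame transport `ιA = cmAdelicFrameTransport L N H dV g hg : U(H)(𝔸_{L⁺}) →* U(diag dV)(𝔸_{L⁺})`, `k ↦ g_𝔸⁻¹ k g_𝔸`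
(★ `ThetaLiftFromLineFrame`), is a bijection respecting the decomposition `G(𝔸) = G_∞ × G(𝔸_f)` and, inside `G_∞ = ∏_w G(L⁺_w)`, the
place-by-place factorisation ([BorelJacquet1979, §4.1]).  Hence the one-place element `adelicSingle w₀ u = ((u at w₀, 1 at w ≠ w₀), 1_f)` of
`U(diag dV)(𝔸_{L⁺})` (★ `UnitaryGroupArchSection`) is `ιA` of an ARCHIMEDEAN element `(a, 1_f)` of `U(H)(𝔸_{L⁺})` whose components away
from `w₀` are trivial (§1, any `N`, any frame); for `N = 3` and `w₀ ≠ w(ι)` that element lies in the compact factor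
`K_c = cmCompactFactor L ι H T hT` (★ `UnitaryGroupCohomologicalForms`: the archimedean elements with trivial `ι`-component) (§2); so the
projected theta classes of a holomorphic-cotangent `P` are invariant under the Weil action of `(adelicSingle w₀ u, 1)` for EVERY
`u ∈ U(σ_{w₀} diag dV)(ℂ)` (§3 = ★ FILE A `starProjection_toLp_lineThetaLift_pairRep_of_mem_cmCompactFactor` at that element) — the
`U(V_{w₀})`-invariance of the theta functional `Ψ ↦ pr_P [Θ̃_Ψ(f) ∘ ιA]` that the (3′) closer pairs with the archimedean Weil data at `w₀`
([Liu2021, proof of Prop. 4.13 Case 1, l. 2137–2141]: «`π_{∞i}` is the trivial character for `i ≥ 2`»).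

* `exists_arch_cmAdelicFrameTransport_archToAdelic_eq_adelicSingle` (§1);
* `exists_mem_cmCompactFactor_cmAdelicFrameTransport_eq_adelicSingle` (§2);
* `starProjection_toLp_lineThetaLift_pairRep_adelicSingle`, `…_sub_adelicSingle` (§3).

HONEST SCOPE.  Group bookkeeping only ([BorelJacquet1979, §4.1]); nothing of [Liu2021] is asserted, nothing archimedean is computed.  HC_CM is
proved only modulo the printed citations until rung 0 closes; this file books nothing and discharges nothing booked.

## References
* [BorelJacquet1979] A. Borel, H. Jacquet, PSPM 33.1 (1979), §4.1 (`G(𝔸) = G_∞ × G(𝔸_f)`, `G_∞ = ∏_{v ∣ ∞} G(F_v)`), §4.6.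
* [Liu2021] Y. Liu, Camb. J. Math. 9 (2021) = arXiv:2102.11518, proof of Prop. 4.13 Case 1 (l. 2137–2141, p. 48); App. D Lem. D.2 (1) (l. 5283).
* [PlatonovRapinchuk1994] V. Platonov, A. Rapinchuk, *Algebraic Groups and Number Theory* (1994), §5.1.
-/

set_option autoImplicit false

noncomputable section

open NumberField NumberField.InfinitePlace NumberField.mixedEmbedding MeasureTheory IsDedekindDomain
open scoped Matrix ComplexOrder ENNReal

namespace Literature.NumberTheory.Automorphic.Liu2021

open _root_.MeasureTheory
open Literature.NumberTheory.Automorphic Literature.NumberTheory.Automorphic.UnitaryGroup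
open Literature.NumberTheory.Automorphic.UnitaryGroup.CotangentForms
open Literature.NumberTheory.Automorphic.IdeleClassGroup
open Literature.NumberTheory.Automorphic.Liu2021.Def411WeilCarriers
open Literature.NumberTheory.Automorphic.Liu2021.Def411WeilCarriersDoubling
open Literature.NumberTheory.GelbartRogawski1991 Literature.NumberTheory.GelbartRogawski1991.UnitaryDualPair
open Literature.NumberTheory.Weil1964
open Literature.RepresentationTheory.Liu2021

/-! ## §1 Any `N`, any frame: `adelicSingle w₀ u` is the transport of an archimedean element trivial away from `w₀` -/

section Frame

variable (L : Type) [Field L] [NumberField L] [IsCMField L] {N : ℕ} (H : Matrix (Fin N) (Fin N) L) (dV : Fin N → L) (g : GL (Fin N) L)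
  (hg : ((g : Matrix (Fin N) (Fin N) L).map (cmConjRingHom L))ᵀ * H * (g : Matrix (Fin N) (Fin N) L) = Matrix.diagonal dV)

/-- **THE ONE-PLACE ELEMENT THROUGH THE FRAME TRANSPORT**: for a complex place `w₀` of `L` and `u ∈ U(σ_{w₀} diag dV)(ℂ)` there is an
archimedean `a ∈ U(H)(L⁺ ⊗ ℝ)` with `ιA (a, 1_f) = adelicSingle w₀ u = ((u at w₀, 1 elsewhere), 1_f)` and `a_w = 1` for every `w ≠ w₀`
(`a = g_∞ · (u at w₀, 1 elsewhere) · g_∞⁻¹`: the transport `k ↦ g_𝔸⁻¹ k g_𝔸` is a bijection compatible with `G(𝔸) = G_∞ × G(𝔸_f)` and with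
the factorisation of `G_∞` place by place). [cite: BorelJacquet1979, §4.1] [cite: PlatonovRapinchuk1994, §5.1] -/
theorem exists_arch_cmAdelicFrameTransport_archToAdelic_eq_adelicSingle (w₀ : {w : InfinitePlace L // w.IsComplex})
    (u : UnitaryGroup.archLocal L N (Matrix.diagonal dV) w₀) :
    ∃ a : UnitaryGroup.arch (↥(maximalRealSubfield L)) L (IsCMField.complexConj L) N H,
      cmAdelicFrameTransport L N H dV g hg (UnitaryGroup.archToAdelic (↥(maximalRealSubfield L)) L (IsCMField.complexConj L) N H a) =
          UnitaryGroup.adelicSingle (↥(maximalRealSubfield L)) L (IsCMField.complexConj L) N (Matrix.diagonal dV) (IsCMField.complexConj_ne_one L)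
            (complexConj_smul_infinitePlace L) w₀ u ∧
        ∀ w : {w : InfinitePlace L // w.IsComplex}, w ≠ w₀ →
          UnitaryGroup.archAt (↥(maximalRealSubfield L)) L (IsCMField.complexConj L) N H w (complexConj_smul_infinitePlace L w.1)
            (IsCMField.complexConj_ne_one L) a = 1 := by
  set y := UnitaryGroup.adelicSingle (↥(maximalRealSubfield L)) L (IsCMField.complexConj L) N (Matrix.diagonal dV)
    (IsCMField.complexConj_ne_one L) (complexConj_smul_infinitePlace L) w₀ u with hy
  -- the preimage `k = g_𝔸 y g_𝔸⁻¹` of `y` under the frame transport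
  set k : (adelicGroupData (↥(maximalRealSubfield L)) L (IsCMField.complexConj L) N H).Adelic :=
    cmAdelicEquiv L N H ((cmFrameEquiv L g H dV hg).symm y) with hk
  -- matrices: `k = g_𝔸 · y · g_𝔸⁻¹` in `GL_N(𝔸_L)`
  have hkmat : UnitaryGroup.adelicVal (↥(maximalRealSubfield L)) L (IsCMField.complexConj L) N H k =
      toAdeleGL L g * UnitaryGroup.adelicVal (↥(maximalRealSubfield L)) L (IsCMField.complexConj L) N (Matrix.diagonal dV) y *
        (toAdeleGL L g)⁻¹ := by
    have h := coe_cmFrameEquiv L g H dV hg ((cmFrameEquiv L g H dV hg).symm y)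
    rw [ContinuousMulEquiv.apply_symm_apply] at h
    rw [UnitaryGroup.adelicVal_apply, UnitaryGroup.adelicVal_apply, hk, coe_cmAdelicEquiv, h]
    group
  -- the frame transport of `k` is `y`
  have hky : cmAdelicFrameTransport L N H dV g hg k = y := by
    apply Subtype.ext
    rw [coe_cmAdelicFrameTransport, hkmat, ← UnitaryGroup.adelicVal_apply]
    group
  -- the finite part of `k` is trivial
  have hfin : UnitaryGroup.finPart (↥(maximalRealSubfield L)) L (IsCMField.complexConj L) N H k = 1 := by
    apply Subtype.ext
    have hyf : GLn.sndHom N L (UnitaryGroup.adelicVal (↥(maximalRealSubfield L)) L (IsCMField.complexConj L) N (Matrix.diagonal dV) y) = 1 := by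
      rw [← UnitaryGroup.coe_finPart, hy, UnitaryGroup.finPart_adelicSingle, OneMemClass.coe_one]
    rw [UnitaryGroup.coe_finPart, hkmat, map_mul, map_mul, map_inv, hyf, mul_one, mul_inv_cancel, OneMemClass.coe_one]
  refine ⟨UnitaryGroup.archPart (↥(maximalRealSubfield L)) L (IsCMField.complexConj L) N H k, ?_, fun w hw => ?_⟩
  · -- `(k_∞, 1_f) = k` since `k_f = 1`
    have h := UnitaryGroup.archToAdelic_mul_finAdelicToAdelic (↥(maximalRealSubfield L)) L (IsCMField.complexConj L) N H k
    rw [hfin, map_one, mul_one] at h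
    rw [h, hky]
  · -- the `w`-component of `k_∞ = g_∞ · (u at w₀) · g_∞⁻¹` is `g_w · 1 · g_w⁻¹ = 1`
    apply Subtype.ext
    have hyw : Matrix.GeneralLinearGroup.map (evalC L w)
        (GLn.toMixed N L (UnitaryGroup.adelicVal (↥(maximalRealSubfield L)) L (IsCMField.complexConj L) N (Matrix.diagonal dV) y)) = 1 := by
      rw [← UnitaryGroup.coe_archPart, ← UnitaryGroup.coe_archAt (hw := complexConj_smul_infinitePlace L w.1)
        (hc := IsCMField.complexConj_ne_one L), hy, UnitaryGroup.archPart_adelicSingle,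
        UnitaryGroup.archAt_archSingle_of_ne (↥(maximalRealSubfield L)) L (IsCMField.complexConj L) N (Matrix.diagonal dV)
          (IsCMField.complexConj_ne_one L) (complexConj_smul_infinitePlace L) w₀ hw u, OneMemClass.coe_one]
    rw [UnitaryGroup.coe_archAt, UnitaryGroup.coe_archPart, hkmat, map_mul, map_mul, map_inv, map_mul, map_mul, map_inv, hyw, mul_one,
      mul_inv_cancel, OneMemClass.coe_one]

end Frame

/-! ## §2 `N = 3`: the one-place elements away from `ι` are transports of elements of the compact factor `K_c` -/

section Compact

variable (L : Type) [Field L] [NumberField L] [IsCMField L] (ι : L →+* ℂ) (H : Matrix (Fin 3) (Fin 3) L) (T : GL (Fin 3) ℂ)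
  (hT : (T : Matrix (Fin 3) (Fin 3) ℂ)ᴴ * H.map ι * (T : Matrix (Fin 3) (Fin 3) ℂ) = Literature.Geometry.ComplexHyperbolic.BallModel.J)
  (dV : Fin 3 → L) (g : GL (Fin 3) L)
  (hg : ((g : Matrix (Fin 3) (Fin 3) L).map (cmConjRingHom L))ᵀ * H * (g : Matrix (Fin 3) (Fin 3) L) = Matrix.diagonal dV)

/-- **`adelicSingle w₀ u ∈ ιA(K_c)` for `w₀ ≠ w(ι)`**: for every complex place `w₀` of `L` other than that of `ι` and every
`u ∈ U(σ_{w₀} diag dV)(ℂ)`, the one-place element `((u at w₀, 1 elsewhere), 1_f)` of `U(diag dV)(𝔸_{L⁺})` is the frame transport of an element of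
the compact factor `K_c = cmCompactFactor L ι H T hT` (the archimedean elements of `U(H)(𝔸_{L⁺})` with trivial `ι`-component, ★ `ker_archProjU21Emb`).
[cite: BorelJacquet1979, §4.1] [cite: PlatonovRapinchuk1994, §5.1] -/
theorem exists_mem_cmCompactFactor_cmAdelicFrameTransport_eq_adelicSingle (w₀ : {w : InfinitePlace L // w.IsComplex})
    (hw₀ : w₀.1 ≠ InfinitePlace.mk ι) (u : UnitaryGroup.archLocal L 3 (Matrix.diagonal dV) w₀) :
    ∃ k ∈ cmCompactFactor L ι H T hT,
      cmAdelicFrameTransport L 3 H dV g hg k =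
        UnitaryGroup.adelicSingle (↥(maximalRealSubfield L)) L (IsCMField.complexConj L) 3 (Matrix.diagonal dV) (IsCMField.complexConj_ne_one L)
          (complexConj_smul_infinitePlace L) w₀ u := by
  obtain ⟨a, ha, hcomp⟩ := exists_arch_cmAdelicFrameTransport_archToAdelic_eq_adelicSingle L H dV g hg w₀ u
  refine ⟨UnitaryGroup.archToAdelic (↥(maximalRealSubfield L)) L (IsCMField.complexConj L) 3 H a, ?_, ha⟩
  rw [cmCompactFactor_eq]
  refine Subgroup.mem_map_of_mem _ ?_
  have hne : placeOf L ι (isComplex_mk_of_isCMField L ι) ≠ w₀ := fun h => hw₀ (by rw [← h])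
  have hker : a ∈ (UnitaryGroup.archAt (↥(maximalRealSubfield L)) L (IsCMField.complexConj L) 3 H (placeOf L ι (isComplex_mk_of_isCMField L ι))
      (complexConj_smul_infinitePlace L _) (IsCMField.complexConj_ne_one L)).ker := by
    rw [MonoidHom.mem_ker]
    exact hcomp _ hne
  rw [archProjU21EmbCM, ker_archProjU21Emb]
  exact hker

end Compact

/-! ## §3 The projected theta classes of a holomorphic-cotangent `P` are invariant under `(adelicSingle w₀ u, 1)` (`w₀ ≠ w(ι)`) -/

section Theta


variable (L : Type) [Field L] [NumberField L] [IsCMField L] (ι : L →+* ℂ) (H : Matrix (Fin 3) (Fin 3) L) (T : GL (Fin 3) ℂ)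
  (hT : (T : Matrix (Fin 3) (Fin 3) ℂ)ᴴ * H.map ι * (T : Matrix (Fin 3) (Fin 3) ℂ) = Literature.Geometry.ComplexHyperbolic.BallModel.J)
  {n' : ℕ} (e₁ : Fin 3 × Fin 1 ≃ Fin n') (dV : Fin 3 → L) (hdV : ∀ i, IsCMField.complexConj L (dV i) = dV i)
  (hdV0 : ∀ i, dV i ≠ 0) (g : GL (Fin 3) L)
  (hg : ((g : Matrix (Fin 3) (Fin 3) L).map (cmConjRingHom L))ᵀ * H * (g : Matrix (Fin 3) (Fin 3) L) = Matrix.diagonal dV)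
  (μ : Literature.NumberTheory.Automorphic.IdeleClassGroup L →ₜ* Circle) (hμ : IsConjugateSymplectic L μ) (a : (↥(maximalRealSubfield L))ˣ)
  (hρ : HasThetaMajorants fun
      (p : ↥(UnitaryGroup.adelic (↥(maximalRealSubfield L)) L (IsCMField.complexConj L) 3 (Matrix.diagonal dV)) × ↥(UnitaryGroup.adelic (↥(maximalRealSubfield L)) L (IsCMField.complexConj L) 1 (JW (↥(maximalRealSubfield L)) L a))) (Φ : piSchwartzBruhat (↥(maximalRealSubfield L)) (Fin n')) =>
        pairRep (↥(maximalRealSubfield L)) L (IsCMField.complexConj L) 3 1 e₁ (Matrix.diagonal dV) (JW (↥(maximalRealSubfield L)) L a)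
          (chiSplittingLine L e₁ dV hdV hdV0 (toHeckeCharacter L μ) (isUnitary_toHeckeCharacter L μ)
            ((isOscillatorChar_toHeckeCharacter_iff μ).mpr hμ) (TW (↥(maximalRealSubfield L)) a)
            (isUnit_det_TW (↥(maximalRealSubfield L)) a) (JW (↥(maximalRealSubfield L)) L a) (JW_eq (↥(maximalRealSubfield L)) L a))
          p Φ)
  [CompactSpace (↥(UnitaryGroup.adelic (↥(maximalRealSubfield L)) L (IsCMField.complexConj L) 3 (Matrix.diagonal dV)) ⧸ (UnitaryGroup.toAdelic (↥(maximalRealSubfield L)) L (IsCMField.complexConj L) 3 (Matrix.diagonal dV)).range)] [MeasurableSpace (↥(UnitaryGroup.adelic (↥(maximalRealSubfield L)) L (IsCMField.complexConj L) 1 (JW (↥(maximalRealSubfield L)) L a)) ⧸ (UnitaryGroup.toAdelic (↥(maximalRealSubfield L)) L (IsCMField.complexConj L) 1 (JW (↥(maximalRealSubfield L)) L a)).range)] [BorelSpace (↥(UnitaryGroup.adelic (↥(maximalRealSubfield L)) L (IsCMField.complexConj L) 1 (JW (↥(maximalRealSubfield L)) L a)) ⧸ (UnitaryGroup.toAdelic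 (↥(maximalRealSubfield L)) L (IsCMField.complexConj L) 1 (JW (↥(maximalRealSubfield L)) L a)).range)] (μW : Measure (↥(UnitaryGroup.adelic (↥(maximalRealSubfield L)) L (IsCMField.complexConj L) 1 (JW (↥(maximalRealSubfield L)) L a)) ⧸ (UnitaryGroup.toAdelic (↥(maximalRealSubfield L)) L (IsCMField.complexConj L) 1 (JW (↥(maximalRealSubfield L)) L a)).range)) [IsFiniteMeasure μW]
  (Ψ : piSchwartzBruhat (↥(maximalRealSubfield L)) (Fin n'))
  (f : C((↥(UnitaryGroup.adelic (↥(maximalRealSubfield L)) L (IsCMField.complexConj L) 1 (JW (↥(maximalRealSubfield L)) L a)) ⧸ (UnitaryGroup.toAdelic (↥(maximalRealSubfield L)) L (IsCMField.complexConj L) 1 (JW (↥(maximalRealSubfield L)) L a)).range), ℂ))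
  {μA : Measure (adelicGroupData (↥(maximalRealSubfield L)) L (IsCMField.complexConj L) 3 H).automorphicQuotient}
  [(adelicGroupData (↥(maximalRealSubfield L)) L (IsCMField.complexConj L) 3 H).IsAutomorphicMeasure μA]
  [CompactSpace (adelicGroupData (↥(maximalRealSubfield L)) L (IsCMField.complexConj L) 3 H).automorphicQuotient]
  (P : DiscreteAutomorphicRep (adelicGroupData (↥(maximalRealSubfield L)) L (IsCMField.complexConj L) 3 H) μA)
  {Φh : (adelicGroupData (↥(maximalRealSubfield L)) L (IsCMField.complexConj L) 3 H).Adelic → (Fin 2 → ℂ)}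
  (hΦh : Φh ∈ holCotForms (↥(maximalRealSubfield L)) L (IsCMField.complexConj L) 3 H (cmArchSection L ι H T hT)
    (cmCompactFactor L ι H T hT))
  {j : Fin 2} (hj : MemLp (toQuotFun (adelicGroupData (↥(maximalRealSubfield L)) L (IsCMField.complexConj L) 3 H) fun x => Φh x j) 2 μA)
  (hjmem : hj.toLp _ ∈ P.space.toSubmodule) (hjne : hj.toLp _ ≠ 0)

include hΦh hjmem hjne in
/-- **THE THETA FUNCTIONAL IS `U(V_{w₀})`-INVARIANT at every complex place `w₀ ≠ w(ι)`**: for a holomorphic-cotangent `P` (one non-zero coordinate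
class in `P`), every `u ∈ U(σ_{w₀} diag dV)(ℂ)`, every Schwartz–Bruhat `Ψ` and every weight `f`:
`pr_P [Θ̃_{ω((adelicSingle w₀ u), 1)Ψ}(f) ∘ ιA] = pr_P [Θ̃_Ψ(f) ∘ ιA]` (★ FILE A `starProjection_toLp_lineThetaLift_pairRep_of_mem_cmCompactFactor` at the
element of `K_c` of §2) — Liu's «`π_{∞,w₀}` is the trivial character» read on the theta lift.
[cite: Liu2021, proof of Prop. 4.13 Case 1 (l. 2137–2141, p. 48); App. D Lem. D.2 (1) (l. 5283)] [cite: BorelJacquet1979, §4.6] -/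
theorem starProjection_toLp_lineThetaLift_pairRep_adelicSingle (w₀ : {w : InfinitePlace L // w.IsComplex}) (hw₀ : w₀.1 ≠ InfinitePlace.mk ι)
    (u : UnitaryGroup.archLocal L 3 (Matrix.diagonal dV) w₀) :
    P.space.toSubmodule.starProjection
        (MemLp.toLp _ (memLp_toQuotFun_lineThetaLift L 3 H e₁ dV hdV hdV0 g hg μ hμ a hρ μW
          ((pairRep (↥(maximalRealSubfield L)) L (IsCMField.complexConj L) 3 1 e₁ (Matrix.diagonal dV) (JW (↥(maximalRealSubfield L)) L a)
            (chiSplittingLine L e₁ dV hdV hdV0 (toHeckeCharacter L μ) (isUnitary_toHeckeCharacter L μ)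
              ((isOscillatorChar_toHeckeCharacter_iff μ).mpr hμ) (TW (↥(maximalRealSubfield L)) a)
              (isUnit_det_TW (↥(maximalRealSubfield L)) a) (JW (↥(maximalRealSubfield L)) L a) (JW_eq (↥(maximalRealSubfield L)) L a)))
            (UnitaryGroup.adelicSingle (↥(maximalRealSubfield L)) L (IsCMField.complexConj L) 3 (Matrix.diagonal dV) (IsCMField.complexConj_ne_one L)
              (complexConj_smul_infinitePlace L) w₀ u, 1) Ψ) f μA 2)) =
      P.space.toSubmodule.starProjection
        (MemLp.toLp _ (memLp_toQuotFun_lineThetaLift L 3 H e₁ dV hdV hdV0 g hg μ hμ a hρ μW Ψ f μA 2)) := by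
  obtain ⟨k, hk, hke⟩ := exists_mem_cmCompactFactor_cmAdelicFrameTransport_eq_adelicSingle L ι H T hT dV g hg w₀ hw₀ u
  rw [← hke]
  exact starProjection_toLp_lineThetaLift_pairRep_of_mem_cmCompactFactor L ι H T hT e₁ dV hdV hdV0 g hg μ hμ a hρ μW Ψ f P hΦh hj
    hjmem hjne hk

include hΦh hjmem hjne in
/-- **Coinvariant form at the place `w₀ ≠ w(ι)`**: `pr_P` kills the class of `ω((adelicSingle w₀ u), 1)Ψ − Ψ` — the theta functional
`Ψ ↦ pr_P [Θ̃_Ψ(f) ∘ ιA]` factors through the co-invariants of the Weil representation restricted to `U(V_{w₀}) × 1`.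
[cite: Liu2021, App. D Lem. D.2 (1) (l. 5283)] [cite: BorelJacquet1979, §4.6] -/
theorem starProjection_toLp_lineThetaLift_pairRep_sub_adelicSingle (w₀ : {w : InfinitePlace L // w.IsComplex})
    (hw₀ : w₀.1 ≠ InfinitePlace.mk ι) (u : UnitaryGroup.archLocal L 3 (Matrix.diagonal dV) w₀) :
    P.space.toSubmodule.starProjection
        (MemLp.toLp _ (memLp_toQuotFun_lineThetaLift L 3 H e₁ dV hdV hdV0 g hg μ hμ a hρ μW
          ((pairRep (↥(maximalRealSubfield L)) L (IsCMField.complexConj L) 3 1 e₁ (Matrix.diagonal dV) (JW (↥(maximalRealSubfield L)) L a)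
            (chiSplittingLine L e₁ dV hdV hdV0 (toHeckeCharacter L μ) (isUnitary_toHeckeCharacter L μ)
              ((isOscillatorChar_toHeckeCharacter_iff μ).mpr hμ) (TW (↥(maximalRealSubfield L)) a)
              (isUnit_det_TW (↥(maximalRealSubfield L)) a) (JW (↥(maximalRealSubfield L)) L a) (JW_eq (↥(maximalRealSubfield L)) L a)))
            (UnitaryGroup.adelicSingle (↥(maximalRealSubfield L)) L (IsCMField.complexConj L) 3 (Matrix.diagonal dV) (IsCMField.complexConj_ne_one L)
              (complexConj_smul_infinitePlace L) w₀ u, 1) Ψ - Ψ) f μA 2)) = 0 := by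
  obtain ⟨k, hk, hke⟩ := exists_mem_cmCompactFactor_cmAdelicFrameTransport_eq_adelicSingle L ι H T hT dV g hg w₀ hw₀ u
  rw [← hke]
  exact starProjection_toLp_lineThetaLift_pairRep_sub_of_mem_cmCompactFactor L ι H T hT e₁ dV hdV hdV0 g hg μ hμ a hρ μW Ψ f P hΦh hj
    hjmem hjne hk

end Theta

end Literature.NumberTheory.Automorphic.Liu2021

end
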